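import Literature.NumberTheory.EllipticCurves.SkinnerUrban2014.PAdicUnitPeriodRatioProofs
import Literature.NumberTheory.EllipticCurves.ImaginaryPeriod
import HarnessLib

/-!
# Greenberg–Vatsal 2000, Remark 3.4 for the IMAGINARY period: at an odd prime `p` with `E[p]`
# irreducible, `|Ω⁻(E)|` is a `p`-adic unit multiple of the minus period `Ω⁻_f` of the newform —
# PROVED from the Manin constant of the optimal curve (theorems only)

R. Greenberg, V. Vatsal, Invent. Math. 142 (2000), §3, Remark 3.4: *"If `E` does not admit any
`p`-isogenies, so that `E[p]` is irreducible, then it is clear that the Néron periods of any isogenous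
curve differ from those of `E` by a `p`-adic unit"*, combined with the Manin constant of the strong
Weil curve (Edixhoven 1991, Prop. 2: the LATTICE equality `Λ(ω_{E₀}) = c₀ Λ_f`; `p ∤ c₀` by Mazur
1978, Cor. 4.1 / Abbes–Ullmo 1996, Thm. A). The sibling file `PAdicUnitPeriodRatioProofs.lean`
proves this for the REAL Néron period `Ω(E)` against `Ω⁺_f`; this file proves it for the IMAGINARY
period `|Ω⁻(E)|` (`WeierstrassCurve.imaginaryPeriodRat`: the least `t > 0` with `it ∈ Λ_E`, Pal
2012 p. 1514) against `Ω⁻_f` (`ModularForms.minusPeriod`: `im Λ_f = ℤ · Ω⁻_f/2`), by the same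
lattice argument read on imaginary parts. HONEST FRAMING (cell `b2b-bsdres`, home
`run/shared/lean/b2b/bsd-rank1-residual/`; unit x1b GEN 45, class O10): the cell deletes
COMBINATION-shaped residual classes of analytic-rank `≤ 1` curves from PUBLISHED theorems only and
types the construction-shaped ones; this is not "finishing BSD". A *proofs* file (theorems only: no
definition, no named fact, no `sorry`; D-0026). Consumer: the period-ratio binder `hper` of the
quadratic-branch chain (`Summits/…/Additive/QuadraticBranchPeriodRatioOfNamedFact.lean`) at
`p ≡ 3 (mod 4)`, where the twisting field `ℚ(√−p)` is imaginary and Kobayashi's `L_p⁻(V, η, X)` is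
normalised by `Ω⁻`.

## What is proved (§1–§4 fact-free; §5 modulo the Manin-constant facts, exactly as the plus file)
§1 `|Ω⁻(W)|` = least real period of `iΛ_E` for any datum (`imaginaryPeriodRat_eq_minRealPeriod_mulLeft_I`),
`i|Ω⁻| ∈ Λ_E`, `im Λ_E ⊆ ℤ·|Ω⁻|/2`, `Λ_E ∩ iℝ = ℤ·i|Ω⁻|`, `im Λ_f = ℤ·Ω⁻_f/2`. §2
`exists_int_mul_imaginaryPeriodRat_eq_of_isogeny`: `q·|Ω⁻(W)| = a·|Ω⁻(W')|`, `q ∣ d`, `ab = d` under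
a `ℚ`-isogeny of degree `d` between globally minimal models. §3
`exists_dvd_two_mul_imaginaryPeriodRat_eq_of_latticeEq`: `m·|Ω⁻(E₀)| = |c₀|·Ω⁻_f`, `m ∣ 2`, for a
lattice-optimal datum. §4 `exists_unit_mul_minusPeriod_of_irreducible`: `|Ω⁻(W)| = u·Ω⁻_f`,
`u = a|c₀|/(qm)`, `‖u‖_p = 1`. §5 `exists_unit_mul_minusPeriod_of_irreducible_of_mazur` (odd `p`,
`p² ∤ N`) / `…_of_abbesUllmo` (`p ∤ N`); `imaginaryPeriodRat_eq_unit_mul_minusPeriod_of_mazur` /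
`…_of_abbesUllmo` (good `p ≥ 5`) — the minus-period SIBLINGS of the plus named fact
`realPeriodRat_eq_unit_mul_plusPeriod` (`ModularCurvePeriodRatio.lean`), as theorems.
References: [GreenbergVatsal2000] §3 Rem. 3.4; [SkinnerUrban2014] §3.6.7; [Mazur1978] Cor. 4.1;
[AbbesUllmo1996] Thm. A; [EdixhovenManin1991] Prop. 2, §1; [Pal2012] p. 1514; [CremonaAlgorithms1997]
§2.8; [Lawden1989] §6.15; [SilvermanAEC2009] VI.4.1 (b), VI.5.1.
-/

noncomputable section

open scoped Classical

namespace Literature.NumberTheory.EllipticCurves.SkinnerUrban2014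

open _root_.WeierstrassCurve Complex

/-! ### §1. The imaginary period through a modular-parametrisation datum -/

section Lattice

open scoped MatrixGroups ModularForm
open CongruenceSubgroup Literature.NumberTheory.EllipticCurves.ModularForms _root_.PeriodPair

variable {W W' : WeierstrassCurve ℚ} [W.IsElliptic] [W'.IsElliptic] {N N' : ℕ} [NeZero N]
  [NeZero N']

/-- For an integer `z` not divisible by the prime `p`, `‖z‖_p = 1` (private helper). [folklore] -/
private theorem padicNorm_intCast_eq_one_of_not_dvd' {p : ℕ} [Fact p.Prime] {z : ℤ}
    (h : ¬ (p : ℤ) ∣ z) : ‖(z : ℚ_[p])‖ = 1 :=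
  le_antisymm (Padic.norm_int_le_one z)
    (not_lt.mp fun hlt ↦ h (Padic.norm_intCast_lt_one_iff.mp hlt))

/-- For a natural number `n ∣ 2` and an odd prime `p`, `‖n‖_p = 1` (private helper). [folklore] -/
private theorem padicNorm_natCast_eq_one_of_dvd_two' {p : ℕ} [Fact p.Prime] (hp2 : p ≠ 2) {n : ℕ}
    (h : n ∣ 2) : ‖(n : ℚ_[p])‖ = 1 := by
  have hpP : p.Prime := Fact.out
  rw [Padic.norm_natCast_eq_one_iff]
  rcases (Nat.dvd_prime Nat.prime_two).mp h with rfl | rfl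
  · exact Nat.coprime_one_right p
  · exact (Nat.coprime_primes hpP Nat.prime_two).mpr hp2

/-- A real number `t` lies in the rotated lattice `iΛ` iff `it ∈ Λ` (`x ∈ iΛ ↔ −ix ∈ Λ`, and `Λ = −Λ`).
[cite: Pal2012, p. 1514 (Λ ∩ iℝ)] -/
theorem ofReal_mem_mulLeft_I_iff {L : PeriodPair} {t : ℝ} :
    ((t : ℂ)) ∈ (L.mulLeft I I_ne_zero).lattice ↔ I * (t : ℂ) ∈ L.lattice := by
  rw [mem_mulLeft_lattice, Complex.inv_I, neg_mul, neg_mem_iff]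

/-- **`|Ω⁻(W)|` is the least positive real period of the rotated Néron lattice `iΛ_E`** of any datum
`D` of `W` (`imaginaryPeriod_eq`). [cite: Pal2012, p. 1514 (definition of Ω⁻)] [cite: SilvermanAEC2009, Thm. VI.5.1] -/
theorem imaginaryPeriodRat_eq_minRealPeriod_mulLeft_I (D : ModularParametrizationData W N) :
    W.imaginaryPeriodRat = (D.L.mulLeft I I_ne_zero).minRealPeriod := by
  haveI : (W.baseChange ℝ).IsElliptic := by
    rw [WeierstrassCurve.baseChange]; infer_instance
  rw [WeierstrassCurve.imaginaryPeriodRat_def]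
  exact (W.baseChange ℝ).imaginaryPeriod_eq
    (by rw [D.neronLattice_g₂, ModularParametrizationData.baseChange_real_c₄])
    (by rw [D.neronLattice_g₃, ModularParametrizationData.baseChange_real_c₆])

/-- **`i · |Ω⁻(W)| ∈ Λ_E`** (a generator of `Λ_E ∩ iℝ`). [cite: Pal2012, p. 1514] -/
theorem I_mul_imaginaryPeriodRat_mem (D : ModularParametrizationData W N) :
    I * (W.imaginaryPeriodRat : ℂ) ∈ D.L.lattice := by
  rw [imaginaryPeriodRat_eq_minRealPeriod_mulLeft_I D]
  exact D.isReal_neronLattice.I_mul_minRealPeriod_mem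

/-- **`im Λ_E ⊆ ℤ · |Ω⁻(W)|/2`**: `im z ∈ ℤ · |Ω⁻|/2` for every `z ∈ Λ_E` (`z − z̄ = 2i im z ∈ Λ ∩ iℝ`;
Lawden §6.15). [cite: Lawden1989, §6.15] [cite: CremonaAlgorithms1997, §2.8 (p. 26)] -/
theorem exists_im_eq_int_mul_imaginaryPeriodRat_div_two (D : ModularParametrizationData W N)
    {z : ℂ} (hz : z ∈ D.L.lattice) : ∃ k : ℤ, z.im = k * (W.imaginaryPeriodRat / 2) := by
  rw [imaginaryPeriodRat_eq_minRealPeriod_mulLeft_I D]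
  exact D.isReal_neronLattice.exists_im_eq_int_mul_half hz

/-- **`Λ_E ∩ iℝ = ℤ · i|Ω⁻(W)|`**: `it ∈ Λ_E` ⟹ `t ∈ ℤ · |Ω⁻(W)|` (Lawden §6.15).
[cite: Lawden1989, §6.15] [cite: Pal2012, p. 1514] -/
theorem exists_eq_int_mul_imaginaryPeriodRat_of_I_mul_mem (D : ModularParametrizationData W N)
    {t : ℝ} (ht : I * (t : ℂ) ∈ D.L.lattice) : ∃ k : ℤ, t = k * W.imaginaryPeriodRat := by
  rw [imaginaryPeriodRat_eq_minRealPeriod_mulLeft_I D]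
  exact D.isReal_neronLattice.mulLeft_I.exists_eq_int_mul (ofReal_mem_mulLeft_I_iff.mpr ht)

omit [NeZero N] in
/-- If `Ω⁻_f > 0` (so `minusPeriod f` is not the junk value `0`) then `im Λ_f = ℤ · (Ω⁻_f/2)`, by
the definition of `minusPeriod` (Cremona §2.8). [cite: CremonaAlgorithms1997, §2.8 (p. 26)] -/
theorem imagPeriods_eq_zmultiples_of_minusPeriod_pos (f : CuspForm (Gamma0 N) 2)
    (h : 0 < minusPeriod f) :
    imagPeriods f = AddSubgroup.zmultiples (minusPeriod f / 2) := by
  classical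
  have hex : ∃ Ω : ℝ, 0 < Ω ∧ imagPeriods f = AddSubgroup.zmultiples (Ω / 2) := by
    by_contra hex
    simp [minusPeriod, dif_neg hex] at h
  simp only [minusPeriod, dif_pos hex]
  exact hex.choose_spec.2

/-! ### §2. The lattice step: imaginary periods of two globally minimal models under a `ℚ`-isogeny -/

/-- **The imaginary periods of two globally minimal models under a `ℚ`-isogeny** `ψ : W → W'` of
degree `d` (data `D, D'` used only for their Néron lattices `Λ, Λ'`): integers `q ≠ 0`, `q ∣ d`,
`ab = d` with `q · |Ω⁻(W)| = a · |Ω⁻(W')|`. As the real-period lemma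
`exists_int_mul_minRealPeriod_eq_of_isogeny`, read on `Λ ∩ iℝ = ℤ · i|Ω⁻|`: `ψ` is `z ↦ qz` with
`qΛ ⊆ Λ'`, `[Λ' : qΛ] = d` (`exists_rat_mulLeft_lattice_le_of_isogeny`), `q, d/q ∈ ℤ` by Néron
integrality (`integral_neronScaling_of_isGloballyMinimal_holds`), `q·i|Ω⁻| ∈ Λ'`, `(d/q)·i|Ω⁻'| ∈ Λ`
(Greenberg–Vatsal's "the Néron periods of any isogenous curve").
[cite: GreenbergVatsal2000, §3, Remark 3.4] [cite: SilvermanAEC2009, Thm. VI.4.1(b)] -/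
theorem exists_int_mul_imaginaryPeriodRat_eq_of_isogeny [W.IsGloballyMinimal] [W'.IsGloballyMinimal]
    (D : ModularParametrizationData W N) (D' : ModularParametrizationData W' N')
    (ψ : Isogeny W W') :
    ∃ q a b : ℤ, q ≠ 0 ∧ q ∣ (ψ.degree : ℤ) ∧ a * b = ψ.degree ∧
      (q : ℝ) * W.imaginaryPeriodRat = a * W'.imaginaryPeriodRat := by
  obtain ⟨r, hr0, hle, hidx⟩ :=
    exists_rat_mulLeft_lattice_le_of_isogeny W W' D.isNeronLattice D'.isNeronLattice ψ
  set d : ℕ := ψ.degree with hd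
  have hr0' : (r : ℚ) ≠ 0 := by
    rintro rfl
    exact hr0 (by push_cast; rfl)
  have hmem : ∀ z ∈ D.L.lattice, ((r : ℚ) : ℂ) * z ∈ D'.L.lattice := fun z hz ↦
    hle (mul_mem_mulLeft_lattice.mpr hz)
  obtain ⟨q, hq⟩ := integral_neronScaling_of_isGloballyMinimal_holds W W' D.L D'.L D.isNeronLattice
    D'.isNeronLattice r hmem
  -- `dΛ' ⊆ rΛ`, i.e. `(d/r)Λ' ⊆ Λ`
  have hdmem : ∀ z ∈ D'.L.lattice, ((d / r : ℚ) : ℂ) * z ∈ D.L.lattice := by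
    intro z hz
    have h1 : d • z ∈ (D.L.mulLeft (r : ℂ) hr0).lattice := by
      have h2 := AddSubgroup.nsmul_relIndex_mem (D.L.mulLeft (r : ℂ) hr0).lattice.toAddSubgroup
        (K := D'.L.lattice.toAddSubgroup) (g := z) hz
      rw [hidx] at h2
      exact h2
    rw [mem_mulLeft_lattice, nsmul_eq_mul] at h1
    have e : ((d / r : ℚ) : ℂ) * z = ((r : ℚ) : ℂ)⁻¹ * ((d : ℂ) * z) := by
      push_cast
      ring
    rw [e]
    exact h1
  obtain ⟨q', hq'⟩ := integral_neronScaling_of_isGloballyMinimal_holds W' W D'.L D.L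
    D'.isNeronLattice D.isNeronLattice (d / r) hdmem
  have hqq' : q * q' = d := by
    have h : (q : ℚ) * q' = d := by
      rw [hq, hq']
      field_simp
    exact_mod_cast h
  set Ω₁ := W.imaginaryPeriodRat with hΩ₁
  set Ω₁' := W'.imaginaryPeriodRat with hΩ₁'
  have hΩ : I * (Ω₁ : ℂ) ∈ D.L.lattice := I_mul_imaginaryPeriodRat_mem D
  have hΩ' : I * (Ω₁' : ℂ) ∈ D'.L.lattice := I_mul_imaginaryPeriodRat_mem D'
  obtain ⟨a, ha⟩ := exists_eq_int_mul_imaginaryPeriodRat_of_I_mul_mem D'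
    (t := (r : ℝ) * Ω₁) (by
      have := hmem _ hΩ
      push_cast at this ⊢
      convert this using 1
      ring)
  obtain ⟨b, hb⟩ := exists_eq_int_mul_imaginaryPeriodRat_of_I_mul_mem D
    (t := ((d / r : ℚ) : ℝ) * Ω₁') (by
      have := hdmem _ hΩ'
      push_cast at this ⊢
      convert this using 1
      ring)
  have hpos : 0 < Ω₁ := W.imaginaryPeriodRat_pos
  have hpos' : 0 < Ω₁' := W'.imaginaryPeriodRat_pos
  have hab : a * b = d := by
    -- multiply the two relations: `r Ω₁ · (d/r) Ω₁' = a b Ω₁' Ω₁`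
    have h1 : ((r : ℝ) * Ω₁) * (((d / r : ℚ) : ℝ) * Ω₁') = (a * b : ℝ) * (Ω₁ * Ω₁') := by
      rw [ha, hb]; ring
    have hrR : ((r : ℚ) : ℝ) ≠ 0 := by exact_mod_cast hr0'
    have h2 : ((r : ℝ) * Ω₁) * (((d / r : ℚ) : ℝ) * Ω₁') = (d : ℝ) * (Ω₁ * Ω₁') := by
      push_cast
      field_simp
    have h3 : ((a * b : ℤ) : ℝ) = d := by
      have := h1.symm.trans h2
      have hne : Ω₁ * Ω₁' ≠ 0 := (mul_pos hpos hpos').ne'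
      exact_mod_cast mul_right_cancel₀ hne this
    exact_mod_cast h3
  refine ⟨q, a, b, ?_, ⟨q', hqq'.symm⟩, hab, ?_⟩
  · rintro rfl
    exact hr0' (by rw [← hq]; simp)
  · rw [← ha, ← hq]
    push_cast
    ring

/-! ### §3. The optimal curve: `|Ω⁻(E₀)| = |c₀| · Ω⁻_f` up to a factor dividing `2` -/

/-- **The imaginary period of the optimal curve against `Ω⁻_f`**: for a lattice-optimal datum `D₀`
(`Λ_{E₀} = c₀ Λ_f`, `c₀ ≠ 0`) of any model `W₀`, `m · |Ω⁻(W₀)| = |c₀| · Ω⁻_f` with `m ∣ 2`: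
`i|Ω⁻| ∈ Λ_{E₀} = c₀Λ_f` gives `2|Ω⁻| = c₀ j Ω⁻_f`, and `Ω⁻_f/2 = im w`, `c₀w ∈ Λ_{E₀}` gives
`c₀ Ω⁻_f = k|Ω⁻|` (`im Λ_{E₀} ⊆ ℤ·|Ω⁻|/2`); so `jk = 2`, `m = |k|` (Edixhoven 1991, Prop. 2 / §1;
Cremona §2.8). [cite: EdixhovenManin1991, Prop. 2 and §1] [cite: CremonaAlgorithms1997, §2.8 (p. 26)] -/
theorem exists_dvd_two_mul_imaginaryPeriodRat_eq_of_latticeEq (D₀ : ModularParametrizationData W N)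
    (hopt : ∀ z ∈ D₀.L.lattice, ∃ w ∈ periodLattice D₀.f, z = D₀.c * w) :
    ∃ m : ℕ, m ∣ 2 ∧ (m : ℝ) * W.imaginaryPeriodRat = |(D₀.c : ℝ)| * minusPeriod D₀.f := by
  have hc0 : D₀.c ≠ 0 := D₀.maninConstant_ne_zero_holds
  have hminus : 0 < minusPeriod D₀.f :=
    IsNewform0.minusPeriod_pos_holds D₀.isNewformOf.1 D₀.isNewformOf.coeffField_eq_bot
  have him : imagPeriods D₀.f = AddSubgroup.zmultiples (minusPeriod D₀.f / 2) :=
    imagPeriods_eq_zmultiples_of_minusPeriod_pos D₀.f hminus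
  set Ω₁ := W.imaginaryPeriodRat with hΩ₁
  have hpos : 0 < Ω₁ := W.imaginaryPeriodRat_pos
  -- (i) `i Ω₁ = c₀ w`, `w ∈ Λ_f`, so `Ω₁ = c₀ · im w` and `im w = j Ω⁻_f/2`
  obtain ⟨w, hw, hΩw⟩ := hopt _ (I_mul_imaginaryPeriodRat_mem D₀)
  have hwim : w.im ∈ imagPeriods D₀.f := by
    rw [imagPeriods, AddSubgroup.mem_map]
    exact ⟨w, hw, rfl⟩
  rw [him, AddSubgroup.mem_zmultiples_iff] at hwim
  obtain ⟨j, hj⟩ := hwim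
  have h1 : Ω₁ = D₀.c * w.im := by
    have := congrArg Complex.im hΩw
    simpa using this
  -- (ii) `Ω⁻_f/2 = im w'`, `w' ∈ Λ_f`, `c₀ w' ∈ Λ_{E₀}`, so `c₀ Ω⁻_f/2 = k Ω₁/2`
  have hmem : minusPeriod D₀.f / 2 ∈ imagPeriods D₀.f := by
    rw [him]
    exact AddSubgroup.mem_zmultiples _
  rw [imagPeriods, AddSubgroup.mem_map] at hmem
  obtain ⟨w', hw', hw'im⟩ := hmem
  have hw'im' : w'.im = minusPeriod D₀.f / 2 := by simpa using hw'im
  have hcw' : (D₀.c : ℂ) * w' ∈ D₀.L.lattice := D₀.smul_periodLattice_le w' hw'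
  obtain ⟨k, hk⟩ := exists_im_eq_int_mul_imaginaryPeriodRat_div_two D₀ hcw'
  have hmul : ((D₀.c : ℂ) * w').im = (D₀.c : ℝ) * w'.im := by
    simp [Complex.mul_im]
  have h2 : (D₀.c : ℝ) * minusPeriod D₀.f = k * Ω₁ := by
    rw [hmul, hw'im'] at hk
    linarith
  -- `j k = 2`
  have hjk : (j : ℝ) * k = 2 := by
    have e1 : Ω₁ = D₀.c * (j * (minusPeriod D₀.f / 2)) := by rw [h1, ← hj, zsmul_eq_mul]
    -- `2 Ω₁ = j (c₀ Ω⁻_f) = j k Ω₁`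
    have e2 : Ω₁ * 2 = Ω₁ * (j * k) := by
      calc Ω₁ * 2 = j * ((D₀.c : ℝ) * minusPeriod D₀.f) := by rw [e1]; ring
        _ = j * (k * Ω₁) := by rw [h2]
        _ = Ω₁ * (j * k) := by ring
    exact (mul_left_cancel₀ hpos.ne' e2).symm
  have hjk' : j * k = 2 := by exact_mod_cast hjk
  have hk2 : k.natAbs ∣ 2 := by
    have : k ∣ (2 : ℤ) := Dvd.intro_left j hjk'
    simpa using Int.natAbs_dvd_natAbs.mpr this
  refine ⟨k.natAbs, hk2, ?_⟩
  -- `|k| Ω₁ = |c₀| Ω⁻_f` from `c₀ Ω⁻_f = k Ω₁`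
  have habs := congrArg abs h2
  rw [abs_mul, abs_mul, abs_of_pos hminus, abs_of_pos hpos] at habs
  have hcast : ((k.natAbs : ℕ) : ℝ) = |(k : ℝ)| := by
    rw [← Int.cast_natCast, Int.natCast_natAbs, Int.cast_abs]
  rw [hcast]
  exact habs.symm

/-! ### §4. Assembly: `|Ω⁻(W)| = u · Ω⁻_f` with `‖u‖_p = 1` -/

/-- **Greenberg–Vatsal 2000, §3, Remark 3.4 for the IMAGINARY period, PROVED modulo the Manin
constant of the optimal curve**: `W/ℚ` globally minimal, `p` odd, `E[p]` irreducible, `f` the newform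
of `W`, and (`hc`) `p ∤ c₀` for the lattice-optimal datum at the level of `f` ⟹ `|Ω⁻(W)| = u·Ω⁻_f`,
`u = a|c₀|/(qm) ∈ ℚ`, `‖u‖_p = 1` — as `exists_unit_mul_plusPeriod_of_irreducible` (datum of `W`,
optimal datum `D₀` on `W₀ ~ W` by `exists_optimalDatum_of_edixhoven`, isogeny `W → W₀` of degree
prime to `p` by `exists_isogeny_not_dvd_degree_of_irreducible`, then §2 and §3; no real-component
factors occur for `Ω⁻`). [cite: GreenbergVatsal2000, §3, Remark 3.4]
[cite: SkinnerUrban2014, §3.6.7 (p. 45)] [cite: EdixhovenManin1991, Prop. 2 and §1] -/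
theorem exists_unit_mul_minusPeriod_of_irreducible (W : WeierstrassCurve ℚ) [W.IsElliptic]
    [W.IsGloballyMinimal] (p : ℕ) [Fact p.Prime] (hp2 : p ≠ 2)
    (hirr : W.HasIrreducibleModPGaloisRep p) (f : CuspForm (Gamma0 N) 2) (hf : IsNewformOf W f)
    (hc : ∀ (W₀ : WeierstrassCurve ℚ) [W₀.IsElliptic] [W₀.IsGloballyMinimal]
      (D₀ : ModularParametrizationData W₀ N), D₀.f = f →
      (∀ z ∈ D₀.L.lattice, ∃ w ∈ periodLattice D₀.f, z = D₀.c * w) → ¬ (p : ℤ) ∣ D₀.maninConstant) :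
    ∃ u : ℚ, ‖(u : ℚ_[p])‖ = 1 ∧ W.imaginaryPeriodRat = u * minusPeriod f := by
  have hpP : p.Prime := Fact.out
  obtain ⟨D⟩ := Literature.NumberTheory.Automorphic.nonempty_modularParametrizationData_of_isNewformOf hf
  have hDf : D.f = f := D.isNewformOf.unique hf
  subst hDf
  obtain ⟨W₀, hW₀, hW₀', D₀, hf₀, hiso, hopt, -⟩ :=
    D.exists_optimalDatum_of_edixhoven
      (fun hf' hL' q hq hq' ↦ edixhoven_int_of_neronLattice_eq_smul_periodLattice_holds hf' hL' q hq hq')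
  have hc₀ : ¬ (p : ℤ) ∣ D₀.c := hc W₀ D₀ hf₀ hopt
  obtain ⟨ψ, hψ⟩ := exists_isogeny_not_dvd_degree_of_irreducible (W := W) (W' := W₀)
    (Nat.cast_ne_zero.mpr hpP.ne_zero) hirr hiso
  obtain ⟨q, a, b, hq0, hqd, hab, hqa⟩ := exists_int_mul_imaginaryPeriodRat_eq_of_isogeny D D₀ ψ
  obtain ⟨m, hm2, hm⟩ := exists_dvd_two_mul_imaginaryPeriodRat_eq_of_latticeEq D₀ hopt
  have hm0 : (m : ℝ) ≠ 0 := by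
    have : m ≠ 0 := fun h ↦ by rw [h] at hm2; exact absurd hm2 (by decide)
    exact_mod_cast this
  have hq0' : (q : ℝ) ≠ 0 := by exact_mod_cast hq0
  have hpa : ¬ (p : ℤ) ∣ a := fun h ↦ hψ (Int.natCast_dvd_natCast.mp (hab ▸ h.mul_right b))
  have hpq : ¬ (p : ℤ) ∣ q := fun h ↦ hψ (Int.natCast_dvd_natCast.mp (h.trans hqd))
  have hpc : ¬ (p : ℤ) ∣ |D₀.c| := fun h ↦ hc₀ ((dvd_abs _ _).mp h)
  refine ⟨((a : ℚ) * (|D₀.c| : ℤ)) / ((q : ℚ) * m), ?_, ?_⟩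
  · have e : ((((a : ℚ) * (|D₀.c| : ℤ)) / ((q : ℚ) * m) : ℚ) : ℚ_[p]) =
        ((a : ℚ_[p]) * ((|D₀.c| : ℤ) : ℚ_[p])) / ((q : ℚ_[p]) * (m : ℚ_[p])) := by
      simp only [Rat.cast_div, Rat.cast_mul, Rat.cast_natCast, Rat.cast_intCast]
    rw [e, norm_div, norm_mul, norm_mul, padicNorm_intCast_eq_one_of_not_dvd' hpa,
      padicNorm_intCast_eq_one_of_not_dvd' hpc, padicNorm_intCast_eq_one_of_not_dvd' hpq,
      padicNorm_natCast_eq_one_of_dvd_two' hp2 hm2]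
    norm_num
  · -- `|Ω⁻(W)| = (a/q) |Ω⁻(W₀)| = a |c₀| Ω⁻_f / (q m)`
    rw [hf₀, ← Int.cast_abs] at hm
    have h1 : W.imaginaryPeriodRat * ((q : ℝ) * m) =
        ((a : ℝ) * ((|D₀.c| : ℤ) : ℝ)) * minusPeriod D.f := by
      calc W.imaginaryPeriodRat * ((q : ℝ) * m)
          = ((q : ℝ) * W.imaginaryPeriodRat) * m := by ring
        _ = (a * W₀.imaginaryPeriodRat) * m := by rw [hqa]
        _ = a * (m * W₀.imaginaryPeriodRat) := by ring
        _ = ((a : ℝ) * ((|D₀.c| : ℤ) : ℝ)) * minusPeriod D.f := by rw [hm]; ring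
    have hden : ((q : ℝ) * m) ≠ 0 := mul_ne_zero hq0' hm0
    have hcast : ((((a : ℚ) * (|D₀.c| : ℤ)) / ((q : ℚ) * m) : ℚ) : ℝ) =
        ((a : ℝ) * ((|D₀.c| : ℤ) : ℝ)) / ((q : ℝ) * m) := by
      simp only [Rat.cast_div, Rat.cast_mul, Rat.cast_natCast, Rat.cast_intCast]
    rw [hcast, div_mul_eq_mul_div, eq_div_iff hden]
    exact h1

end Lattice

/-! ### §5. The minus-period siblings of the named period-unit facts, from the Manin constant of
the optimal curve (Mazur 1978, Cor. 4.1; Abbes–Ullmo 1996, Thm. A) -/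

section NamedFacts

open scoped MatrixGroups ModularForm
open CongruenceSubgroup Literature.NumberTheory.EllipticCurves.ModularForms

/-- **The imaginary-period unit at an odd prime `p` with `p² ∤ N` and `E[p]` irreducible, from
Mazur 1978, Cor. 4.1** (`mazur_not_dvd_maninConstant_of_odd`): `|Ω⁻(W)| = u · Ω⁻_f`, `‖u‖_p = 1`
(good AND multiplicative odd `p`). [cite: Mazur1978, Cor. 4.1] [cite: GreenbergVatsal2000, §3, Remark 3.4] -/
theorem exists_unit_mul_minusPeriod_of_irreducible_of_mazur
    (hM : mazur_not_dvd_maninConstant_of_odd) (W : WeierstrassCurve ℚ) [W.IsElliptic]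
    [W.IsGloballyMinimal] (p : ℕ) [Fact p.Prime] (hp2 : p ≠ 2)
    (hirr : W.HasIrreducibleModPGaloisRep p) {N : ℕ} [NeZero N] (f : CuspForm (Gamma0 N) 2)
    (hf : IsNewformOf W f) (hpN : ¬ p ^ 2 ∣ N) :
    ∃ u : ℚ, ‖(u : ℚ_[p])‖ = 1 ∧ W.imaginaryPeriodRat = u * minusPeriod f :=
  exists_unit_mul_minusPeriod_of_irreducible W p hp2 hirr f hf
    fun W₀ _ _ D₀ _ hopt ↦ hM W₀ D₀ hopt p Fact.out hp2 hpN

/-- **The same at a GOOD prime (`p ∤ N`) from Abbes–Ullmo 1996, Thm. A**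
(`abbesUllmo_not_dvd_maninConstant_of_not_dvd_level`). [cite: AbbesUllmo1996, Thm. A] [cite: GreenbergVatsal2000, §3, Remark 3.4] -/
theorem exists_unit_mul_minusPeriod_of_irreducible_of_abbesUllmo
    (hAU : abbesUllmo_not_dvd_maninConstant_of_not_dvd_level) (W : WeierstrassCurve ℚ)
    [W.IsElliptic] [W.IsGloballyMinimal] (p : ℕ) [Fact p.Prime] (hp2 : p ≠ 2)
    (hirr : W.HasIrreducibleModPGaloisRep p) {N : ℕ} [NeZero N] (f : CuspForm (Gamma0 N) 2)
    (hf : IsNewformOf W f) (hpN : ¬ p ∣ N) :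
    ∃ u : ℚ, ‖(u : ℚ_[p])‖ = 1 ∧ W.imaginaryPeriodRat = u * minusPeriod f :=
  exists_unit_mul_minusPeriod_of_irreducible W p hp2 hirr f hf
    fun W₀ _ _ D₀ _ hopt ↦ hAU W₀ D₀ hopt p Fact.out hpN

/-- **`|Ω⁻(W)| = u · Ω⁻_f`, `|u|_p = 1`, at a GOOD prime `p ≥ 5` with `E[p]` irreducible, from
Mazur 1978, Cor. 4.1 alone** — the minus-period SIBLING of the named fact
`realPeriodRat_eq_unit_mul_plusPeriod`, in the same binder shape, as a THEOREM granted
`mazur_not_dvd_maninConstant_of_odd` (`p ∤ N_W`, so `p² ∤ N`: `not_dvd_level_of_hasGoodReductionAtPrime`).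
[cite: Mazur1978, Cor. 4.1] [cite: GreenbergVatsal2000, §3, Remark 3.4] [cite: Pal2012, p. 1514] -/
theorem imaginaryPeriodRat_eq_unit_mul_minusPeriod_of_mazur
    (hM : mazur_not_dvd_maninConstant_of_odd) :
    ∀ (W : WeierstrassCurve ℚ) [W.IsElliptic] [W.IsGloballyMinimal] (p : ℕ) [Fact p.Prime],
      5 ≤ p → W.HasGoodReductionAtPrime p → W.HasIrreducibleModPGaloisRep p →
      ∀ {N : ℕ} [NeZero N] (f : CuspForm (Gamma0 N) 2), IsNewformOf W f →
      ∃ u : ℚ, ‖(u : ℚ_[p])‖ = 1 ∧ W.imaginaryPeriodRat = u * minusPeriod f := by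
  intro W _ _ p _ h5 hgood hirr N _ f hf
  have hp2 : p ≠ 2 := by omega
  exact exists_unit_mul_minusPeriod_of_irreducible_of_mazur hM W p hp2 hirr f hf fun h ↦
    not_dvd_level_of_hasGoodReductionAtPrime hgood hf (dvd_trans (dvd_pow_self p two_ne_zero) h)

/-- **The same good-`p ≥ 5` statement from Abbes–Ullmo 1996, Thm. A alone.**
[cite: AbbesUllmo1996, Thm. A] [cite: GreenbergVatsal2000, §3, Remark 3.4] -/
theorem imaginaryPeriodRat_eq_unit_mul_minusPeriod_of_abbesUllmo
    (hAU : abbesUllmo_not_dvd_maninConstant_of_not_dvd_level) :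
    ∀ (W : WeierstrassCurve ℚ) [W.IsElliptic] [W.IsGloballyMinimal] (p : ℕ) [Fact p.Prime],
      5 ≤ p → W.HasGoodReductionAtPrime p → W.HasIrreducibleModPGaloisRep p →
      ∀ {N : ℕ} [NeZero N] (f : CuspForm (Gamma0 N) 2), IsNewformOf W f →
      ∃ u : ℚ, ‖(u : ℚ_[p])‖ = 1 ∧ W.imaginaryPeriodRat = u * minusPeriod f := by
  intro W _ _ p _ h5 hgood hirr N _ f hf
  have hp2 : p ≠ 2 := by omega
  exact exists_unit_mul_minusPeriod_of_irreducible_of_abbesUllmo hAU W p hp2 hirr f hf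
    (not_dvd_level_of_hasGoodReductionAtPrime hgood hf)

end NamedFacts

end Literature.NumberTheory.EllipticCurves.SkinnerUrban2014

end
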